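import Mathlib
import Literature.Analysis.FluidPDE.VectorCalculus
import Summits.NavierStokesRegularity.NavierStokesRegularity.Theorems.SlicedKelvinPlanarFluxAPrioriFoliation
import Summits.NavierStokesRegularity.NavierStokesRegularity.Theorems.SlicedKelvinPlanarFluxAPrioriFoldDecay

/-!
# Crux `SlicedKelvin.PlanarFluxAPriori` (stmt-NavierStokesRegularity-15600), line `Sketch`:
  slab integrals and the one-sided fundamental-theorem estimate (helper for `stub_apexLipschitz`)

The registered stub `stub_apexLipschitz` of the lead's skeleton
`Cruxes/PlanarFluxAPriori/Lines/Sketch.lean` (the half-space apex identity in Lipschitz form)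
compares the plane integrals `g(c) = ∫_{R{x₂ = c}} f²/√(f² + ε²)` at two heights `c, c'` by a SLAB
integral `∫_{⟪x, R e₂⟫ ∈ [c ⊓ c', c ⊔ c']} Q`. This file supplies the two measure-theoretic facts of
that comparison, with no fluid mechanics:

* `apexLipschitz_setIntegral_slab_eq` — for an integrable `Q : ℝ³ → ℝ`, the Bochner integral over
  the slab `{x | ⟪x, R e₂⟫ ∈ [c ⊓ c', c ⊔ c']}` is the height integral over `[c ⊓ c', c ⊔ c']` of the
  plane integrals `s ↦ ∫ Q (R (y₀, y₁, s)) dy` (the foliation chart `(s, y) ↦ R (y₀, y₁, s)` preserves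
  Lebesgue measure, `measurePreserving_foliationChart`; `setIntegral_map`, `setIntegral_prod`; the
  preimage of the slab is `[c ⊓ c', c ⊔ c'] × ℝ²` since `⟪R (y₀, y₁, s), R e₂⟫ = s`), and these plane
  integrals form an integrable function of the height (`apexLipschitz_integrable_planeIntegral`);
* `apexLipschitz_le_add_setIntegral_of_hasDerivAt` — if `g' = φ` everywhere, `φ, ψ` are integrable
  and `|φ| ≤ ψ`, then `g c ≤ g c' + ∫_{[c ⊓ c', c ⊔ c']} ψ` (FTC-2 and `‖∫_{c'}^{c} φ‖ ≤ ∫_{Ι} ‖φ‖`);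
* `apexLipschitz_integrable_density` — the slab integrand of the stub, the apex density
  `(ε²/√(f² + ε²)³) |Df[curl v]|` (`f = ⟪curl v, n⟫`) of a smooth field `v` with cubic decay of its
  derivatives of orders `≤ 3`, is integrable on `ℝ³`: it is continuous and at most
  `ε⁻¹ ‖Df‖ ‖curl v‖ ≤ K (1 + ‖x‖)⁻⁶` (`integrable_one_add_norm`, `3 < 6`; decay bookkeeping of the
  landed `…FoldDecay`, `ε²/√(s² + ε²)³ ≤ ε⁻¹` of `…SqrtReg`).

Mathlib + the landed `…PlanarFluxAPrioriFoliation`, `…PlanarFluxAPrioriFoldDecay` (and through it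
`…PlanarFluxAPrioriSqrtReg`).
-/

noncomputable section

namespace Summit.NavierStokesRegularity.NavierStokesRegularity.Theorems.SlicedKelvinPlanarFluxAPriori

set_option linter.dupNamespace false
-- the summit and its single sub-problem share the name (CONVENTIONS §1)

open MeasureTheory Set
open Literature.Analysis.FluidPDE
open scoped RealInnerProductSpace ContDiff

/-- The height of a chart point: `⟪R (y₀, y₁, s), R e₂⟫ = s`. -/
theorem apexLipschitz_inner_planeChart_normal
    (R : EuclideanSpace ℝ (Fin 3) ≃ₗᵢ[ℝ] EuclideanSpace ℝ (Fin 3)) (y : EuclideanSpace ℝ (Fin 2)) (s : ℝ) :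
    ⟪R (WithLp.toLp 2 ![y 0, y 1, s]), R (EuclideanSpace.single 2 1)⟫ = s := by
  rw [LinearIsometryEquiv.inner_map_map, EuclideanSpace.inner_single_right]
  simp

/-- **Slab integrals are height integrals of plane integrals.** For an integrable `Q : ℝ³ → ℝ`,
a linear isometry `R` and heights `c, c'`, the integral of `Q` over the slab
`{x | ⟪x, R e₂⟫ ∈ [c ⊓ c', c ⊔ c']}` is the integral over `s ∈ [c ⊓ c', c ⊔ c']` of the plane
integrals `∫ Q (R (y₀, y₁, s)) dy` (the foliation chart preserves Lebesgue measure; Fubini). -/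
theorem apexLipschitz_setIntegral_slab_eq : ∀ (R : EuclideanSpace ℝ (Fin 3) ≃ₗᵢ[ℝ] EuclideanSpace ℝ (Fin 3)) (Q : EuclideanSpace ℝ (Fin 3) → ℝ), MeasureTheory.Integrable Q → ∀ (c c' : ℝ), ∫ x in {x : EuclideanSpace ℝ (Fin 3) | inner ℝ x (R (EuclideanSpace.single 2 1)) ∈ Set.uIcc c c'}, Q x = ∫ s in Set.uIcc c c', ∫ y : EuclideanSpace ℝ (Fin 2), Q (R (WithLp.toLp 2 ![y 0, y 1, s])) := by
  intro R Q hQ c c'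
  have hΦ := measurePreserving_foliationChart R
  have hS : MeasurableSet {x : EuclideanSpace ℝ (Fin 3) |
      ⟪x, R (EuclideanSpace.single 2 1)⟫ ∈ Set.uIcc c c'} :=
    (continuous_id.inner continuous_const).measurable measurableSet_uIcc
  have hpre : (fun p : ℝ × EuclideanSpace ℝ (Fin 2) => R (WithLp.toLp 2 ![p.2 0, p.2 1, p.1])) ⁻¹'
      {x : EuclideanSpace ℝ (Fin 3) | ⟪x, R (EuclideanSpace.single 2 1)⟫ ∈ Set.uIcc c c'} =
      Set.uIcc c c' ×ˢ univ := by
    ext p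
    simp only [mem_preimage, mem_setOf_eq, apexLipschitz_inner_planeChart_normal, mem_prod, mem_univ,
      and_true]
  have hint : Integrable (fun p : ℝ × EuclideanSpace ℝ (Fin 2) =>
      Q (R (WithLp.toLp 2 ![p.2 0, p.2 1, p.1]))) ((volume : Measure ℝ).prod volume) :=
    (hΦ.integrable_comp hQ.aestronglyMeasurable).2 hQ
  calc ∫ x in {x : EuclideanSpace ℝ (Fin 3) | ⟪x, R (EuclideanSpace.single 2 1)⟫ ∈ Set.uIcc c c'}, Q x
      = ∫ x in {x : EuclideanSpace ℝ (Fin 3) | ⟪x, R (EuclideanSpace.single 2 1)⟫ ∈ Set.uIcc c c'}, Q x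
          ∂(Measure.map (fun p : ℝ × EuclideanSpace ℝ (Fin 2) => R (WithLp.toLp 2 ![p.2 0, p.2 1, p.1]))
            ((volume : Measure ℝ).prod volume)) := by rw [hΦ.map_eq]
    _ = ∫ p in Set.uIcc c c' ×ˢ (univ : Set (EuclideanSpace ℝ (Fin 2))),
          Q (R (WithLp.toLp 2 ![p.2 0, p.2 1, p.1])) ∂((volume : Measure ℝ).prod volume) := by
        rw [setIntegral_map hS (by rw [hΦ.map_eq]; exact hQ.aestronglyMeasurable)
          hΦ.measurable.aemeasurable, hpre]
    _ = ∫ s in Set.uIcc c c', ∫ y : EuclideanSpace ℝ (Fin 2), Q (R (WithLp.toLp 2 ![y 0, y 1, s])) := by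
        rw [setIntegral_prod _ hint.integrableOn]
        simp only [Measure.restrict_univ]

/-- The plane integrals of an integrable `Q : ℝ³ → ℝ` form an integrable function of the height
(Fubini along the measure-preserving foliation chart). -/
theorem apexLipschitz_integrable_planeIntegral
    (R : EuclideanSpace ℝ (Fin 3) ≃ₗᵢ[ℝ] EuclideanSpace ℝ (Fin 3)) {Q : EuclideanSpace ℝ (Fin 3) → ℝ}
    (hQ : Integrable Q) :
    Integrable (fun s : ℝ => ∫ y : EuclideanSpace ℝ (Fin 2), Q (R (WithLp.toLp 2 ![y 0, y 1, s]))) := by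
  have hΦ := measurePreserving_foliationChart R
  have hint : Integrable (fun p : ℝ × EuclideanSpace ℝ (Fin 2) =>
      Q (R (WithLp.toLp 2 ![p.2 0, p.2 1, p.1]))) ((volume : Measure ℝ).prod volume) :=
    (hΦ.integrable_comp hQ.aestronglyMeasurable).2 hQ
  exact hint.integral_prod_left

/-- **One-sided fundamental-theorem estimate.** If `g` has derivative `φ s` at every height `s`,
`φ` and `ψ` are integrable and `|φ| ≤ ψ`, then `g c ≤ g c' + ∫_{[c ⊓ c', c ⊔ c']} ψ`. -/
theorem apexLipschitz_le_add_setIntegral_of_hasDerivAt {g φ ψ : ℝ → ℝ}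
    (hg : ∀ s, HasDerivAt g (φ s) s) (hφ : Integrable φ) (hψ : Integrable ψ)
    (hle : ∀ s, |φ s| ≤ ψ s) (c c' : ℝ) :
    g c ≤ g c' + ∫ s in Set.uIcc c c', ψ s := by
  have h1 : ∫ s in c'..c, φ s = g c - g c' :=
    intervalIntegral.integral_eq_sub_of_hasDerivAt (fun s _ => hg s) hφ.intervalIntegrable
  have h2 : ∫ s in c'..c, φ s ≤ ∫ s in Set.uIcc c c', ψ s :=
    calc ∫ s in c'..c, φ s ≤ ‖∫ s in c'..c, φ s‖ := Real.le_norm_self _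
      _ ≤ ∫ s in Set.uIoc c' c, ‖φ s‖ := intervalIntegral.norm_integral_le_integral_norm_uIoc
      _ ≤ ∫ s in Set.uIoc c' c, ψ s :=
          setIntegral_mono hφ.norm.integrableOn hψ.integrableOn fun s => by
            rw [Real.norm_eq_abs]; exact hle s
      _ ≤ ∫ s in Set.uIcc c c', ψ s :=
          setIntegral_mono_set hψ.integrableOn
            (ae_of_all _ fun s => (abs_nonneg _).trans (hle s))
            ((uIoc_subset_uIcc.trans_eq (uIcc_comm c' c)).eventuallyLE)
  linarith

/-- **Bulk integrability of the apex density.** For a smooth field `v` with cubic decay of its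
derivatives of orders `≤ 3`, a vector `n`, `ω = curl v`, `f = ⟪ω, n⟫` and `ε > 0`, the apex
density `(ε²/√(f² + ε²)³) |Df[ω]|` is integrable on `ℝ³`: it is continuous and bounded by
`ε⁻¹ ‖Df‖ ‖ω‖ ≤ K (1 + ‖x‖)⁻⁶`. -/
theorem apexLipschitz_integrable_density {ε : ℝ} (hε : 0 < ε) (n : EuclideanSpace ℝ (Fin 3))
    {v : EuclideanSpace ℝ (Fin 3) → EuclideanSpace ℝ (Fin 3)} (hv : ContDiff ℝ ∞ v) {C : ℝ}
    (hC : ∀ (x : EuclideanSpace ℝ (Fin 3)) (k : ℕ), k ≤ 3 →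
      (1 + ‖x‖) ^ 3 * ‖iteratedFDeriv ℝ k v x‖ ≤ C) :
    Integrable (fun x : EuclideanSpace ℝ (Fin 3) =>
      ε ^ 2 / Real.sqrt (⟪curl v x, n⟫ ^ 2 + ε ^ 2) ^ 3 *
        |fderiv ℝ (fun z => ⟪curl v z, n⟫) x (curl v x)|) := by
  obtain ⟨dΩ0, -, -⟩ := decay_zero_one_two fun x k hk => decay_iteratedFDeriv_curl hv hC x k hk
  obtain ⟨-, df1, -⟩ :=
    decay_zero_one_two fun x k hk => decay_iteratedFDeriv_inner_curl hv hC n x k hk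
  have hK0 : 0 ≤ ‖curlCLM‖ * C := le_trans (by positivity) (dΩ0 0)
  have cΩ : Continuous (curl v) := (SlicedKelvinPlanarFluxAPriori.contDiff_curl hv).continuous
  have cDf : Continuous (fderiv ℝ (fun z => ⟪curl v z, n⟫)) :=
    (contDiff_inner_curl hv n).continuous_fderiv (by simp)
  have cG : Continuous (fun z => Real.sqrt (⟪curl v z, n⟫ ^ 2 + ε ^ 2)) :=
    (contDiff_sqrtReg_inner_curl hv hε n).continuous
  have cF2 : Continuous (fun z => ε ^ 2 / Real.sqrt (⟪curl v z, n⟫ ^ 2 + ε ^ 2) ^ 3) :=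
    continuous_const.div (cG.pow 3) fun x => by positivity
  have hcont : Continuous (fun x : EuclideanSpace ℝ (Fin 3) =>
      ε ^ 2 / Real.sqrt (⟪curl v x, n⟫ ^ 2 + ε ^ 2) ^ 3 *
        |fderiv ℝ (fun z => ⟪curl v z, n⟫) x (curl v x)|) :=
    cF2.mul (continuous_abs.comp (cDf.clm_apply cΩ))
  have hint : Integrable (fun x : EuclideanSpace ℝ (Fin 3) => (1 + ‖x‖) ^ (-(6 : ℝ))) :=
    integrable_one_add_norm (by rw [finrank_euclideanSpace_fin]; norm_num)
  refine (hint.const_mul (ε⁻¹ * (‖n‖ * (‖curlCLM‖ * C) * (‖curlCLM‖ * C)))).mono'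
    hcont.aestronglyMeasurable (ae_of_all _ fun x => ?_)
  rw [Real.norm_eq_abs, abs_mul, abs_abs, abs_of_nonneg (sq_div_sqrt_cube_nonneg _ _)]
  have h1 : ‖fderiv ℝ (fun z => ⟪curl v z, n⟫) x‖ ≤ ‖n‖ * (‖curlCLM‖ * C) * (1 + ‖x‖) ^ (-(3 : ℝ)) :=
    le_mul_rpow_neg_three (df1 x)
  have h2 : ‖curl v x‖ ≤ ‖curlCLM‖ * C * (1 + ‖x‖) ^ (-(3 : ℝ)) := le_mul_rpow_neg_three (dΩ0 x)
  have h3 : |fderiv ℝ (fun z => ⟪curl v z, n⟫) x (curl v x)| ≤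
      ‖fderiv ℝ (fun z => ⟪curl v z, n⟫) x‖ * ‖curl v x‖ := by
    rw [← Real.norm_eq_abs]
    exact ContinuousLinearMap.le_opNorm _ _
  have hw : (1 + ‖x‖) ^ (-(3 : ℝ)) * (1 + ‖x‖) ^ (-(3 : ℝ)) = (1 + ‖x‖) ^ (-(6 : ℝ)) := by
    rw [← Real.rpow_add (by positivity)]
    norm_num
  calc ε ^ 2 / Real.sqrt (⟪curl v x, n⟫ ^ 2 + ε ^ 2) ^ 3 * |fderiv ℝ (fun z => ⟪curl v z, n⟫) x (curl v x)|
      ≤ ε⁻¹ * (‖fderiv ℝ (fun z => ⟪curl v z, n⟫) x‖ * ‖curl v x‖) :=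
        mul_le_mul (sq_div_sqrt_cube_le hε _) h3 (abs_nonneg _) (inv_nonneg.2 hε.le)
    _ ≤ ε⁻¹ * ((‖n‖ * (‖curlCLM‖ * C) * (1 + ‖x‖) ^ (-(3 : ℝ))) *
          (‖curlCLM‖ * C * (1 + ‖x‖) ^ (-(3 : ℝ)))) := by
        gcongr
    _ = ε⁻¹ * (‖n‖ * (‖curlCLM‖ * C) * (‖curlCLM‖ * C)) * (1 + ‖x‖) ^ (-(6 : ℝ)) := by
        rw [← hw]; ring

end Summit.NavierStokesRegularity.NavierStokesRegularity.Theorems.SlicedKelvinPlanarFluxAPriori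

end
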